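import Mathlib

/-!
# Symmetric unimodal sequences and their convolution (the parallel step of cellwise anti-diagonal
unimodality; seat mine-b, cell pub-perc-repro2; MINE-B.md §39.6)

`SymUni f n`: `f : ℕ → ℕ` vanishes beyond `n`, is symmetric on `[0,n]` (`f i = f (n−i)`) and non-decreasing on
the left half (`f i ≤ f (i+1)` whenever `2i+2 ≤ n`).  Main result: the convolution of two such sequences is
non-decreasing on the left half of `[0, n₁+n₂]` (`conv_mono`) — by peeling the outermost level `f 0 · 1_{[0,n₁]}`
off `f` (the window sums of `g` are unimodal: `window_mono`) and recursing on the inner sequence shifted by one.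
-/

namespace Summit.Ventures.PercRepro2.Unimodal

/-- symmetric unimodal on `[0,n]`, zero beyond -/
structure SymUni (f : ℕ → ℕ) (n : ℕ) : Prop where
  zero : ∀ i, n < i → f i = 0
  symm : ∀ i, i ≤ n → f i = f (n - i)
  mono : ∀ i, 2 * i + 2 ≤ n → f i ≤ f (i + 1)

/-- `f q ≤ f p` whenever `q ≤ p ≤ n/2` (iterated `mono`) -/
lemma SymUni.le_of_le_half {f : ℕ → ℕ} {n : ℕ} (h : SymUni f n) :
    ∀ d q, 2 * (q + d) ≤ n → f q ≤ f (q + d)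
  | 0, q, _ => le_rfl
  | d + 1, q, hd => by
    have h1 := SymUni.le_of_le_half h d q (by omega)
    have h2 := h.mono (q + d) (by omega)
    calc f q ≤ f (q + d) := h1
      _ ≤ f (q + d + 1) := h2

/-- `f q ≤ f p` whenever `q ≤ p` and `p + q ≤ n` (`p` lies between `q` and its mirror image) -/
lemma SymUni.le_of_between {f : ℕ → ℕ} {n : ℕ} (h : SymUni f n) (p q : ℕ) (hqp : q ≤ p) (hpq : p + q ≤ n) :
    f q ≤ f p := by
  by_cases hp : 2 * p ≤ n
  · obtain ⟨d, rfl⟩ := Nat.exists_eq_add_of_le hqp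
    exact h.le_of_le_half d q hp
  · rw [h.symm p (by omega)]
    obtain ⟨d, hd⟩ := Nat.exists_eq_add_of_le (show q ≤ n - p by omega)
    rw [hd]
    exact h.le_of_le_half d q (by omega)

/-- the window sum `W n₁ g i = Σ_{i₁ ≤ min(i, n₁)} g (i − i₁)` (the convolution of `1_{[0,n₁]}` with `g`) -/
def window (n₁ : ℕ) (g : ℕ → ℕ) (i : ℕ) : ℕ :=
  ∑ i₁ ∈ Finset.range (i + 1), if i₁ ≤ n₁ then g (i - i₁) else 0

/-- `W(i) + g(i+1) = W(i+1) + [n₁ ≤ i]·g(i − n₁)` -/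
lemma window_succ (n₁ : ℕ) (g : ℕ → ℕ) (i : ℕ) :
    window n₁ g i + g (i + 1) = window n₁ g (i + 1) + (if n₁ ≤ i then g (i - n₁) else 0) := by
  unfold window
  rw [Finset.sum_range_succ' (fun i₁ => if i₁ ≤ n₁ then g (i + 1 - i₁) else 0) (i + 1)]
  simp only [zero_le, if_true, Nat.sub_zero]
  have e : ∀ j ∈ Finset.range (i + 1),
      (if j ≤ n₁ then g (i - j) else 0) = (if j + 1 ≤ n₁ then g (i + 1 - (j + 1)) else 0) + (if j = n₁ then g (i - j) else 0) := by
    intro j _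
    rw [show i + 1 - (j + 1) = i - j by omega]
    split_ifs <;> omega
  rw [Finset.sum_congr rfl e, Finset.sum_add_distrib, Finset.sum_ite_eq' (Finset.range (i + 1)) n₁ (fun j => g (i - j))]
  simp only [Finset.mem_range]
  have e2 : (if n₁ < i + 1 then g (i - n₁) else 0) = (if n₁ ≤ i then g (i - n₁) else 0) := by
    split_ifs <;> omega
  rw [e2]; ring

/-- **the window sums of a symmetric unimodal sequence are non-decreasing on the left half** -/
lemma window_mono {g : ℕ → ℕ} {n₂ : ℕ} (hg : SymUni g n₂) (n₁ : ℕ) (i : ℕ) (hi : 2 * i + 2 ≤ n₁ + n₂) :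
    window n₁ g i ≤ window n₁ g (i + 1) := by
  have h := window_succ n₁ g i
  have hle : (if n₁ ≤ i then g (i - n₁) else 0) ≤ g (i + 1) := by
    split_ifs with hn
    · exact hg.le_of_between (i + 1) (i - n₁) (by omega) (by omega)
    · exact Nat.zero_le _
  omega

/-- the convolution `(f ∗ g)(m) = Σ_{i₁ ≤ m} f i₁ · g (m − i₁)` -/
def conv (f g : ℕ → ℕ) (m : ℕ) : ℕ := ∑ i₁ ∈ Finset.range (m + 1), f i₁ * g (m - i₁)

/-- the convolution of the outermost level: `conv (c · 1_{[0,n₁]}) g = c · W` -/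
lemma conv_level (c n₁ : ℕ) (g : ℕ → ℕ) (m : ℕ) :
    conv (fun i => if i ≤ n₁ then c else 0) g m = c * window n₁ g m := by
  unfold conv window
  rw [Finset.mul_sum]
  refine Finset.sum_congr rfl (fun i₁ _ => ?_)
  dsimp only
  split_ifs <;> ring

/-- the convolution of a shifted sequence: `conv (shift f'') g (m+1) = conv f'' g m` -/
lemma conv_shift (f'' g : ℕ → ℕ) (m : ℕ) :
    conv (fun i => if 1 ≤ i then f'' (i - 1) else 0) g (m + 1) = conv f'' g m := by
  unfold conv
  rw [Finset.sum_range_succ' (fun i₁ => (if 1 ≤ i₁ then f'' (i₁ - 1) else 0) * g (m + 1 - i₁)) (m + 1)]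
  simp only [zero_le, le_add_iff_nonneg_left, Nat.add_sub_cancel, if_true, zero_mul, add_zero,
    Nat.sub_zero, show (1 ≤ 0) = False from eq_false (by omega), if_false]
  refine Finset.sum_congr rfl (fun j _ => ?_)
  rw [show m + 1 - (j + 1) = m - j by omega]

/-- the convolution of a shifted sequence at `0` -/
lemma conv_shift_zero (f'' g : ℕ → ℕ) :
    conv (fun i => if 1 ≤ i then f'' (i - 1) else 0) g 0 = 0 := by
  unfold conv; simp

/-- convolution is additive in the first argument -/
lemma conv_add (f₁ f₂ g : ℕ → ℕ) (m : ℕ) :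
    conv (fun i => f₁ i + f₂ i) g m = conv f₁ g m + conv f₂ g m := by
  unfold conv
  rw [← Finset.sum_add_distrib]
  refine Finset.sum_congr rfl (fun i₁ _ => ?_); ring

/-- peeling: a symmetric unimodal `f` on `[0,n₁]`, `n₁ ≥ 2`, is `f 0 · 1_{[0,n₁]}` plus the shift of the
symmetric unimodal sequence `f'' j = f (j+1) − f 0` on `[0, n₁−2]` -/
lemma SymUni.peel {f : ℕ → ℕ} {n₁ : ℕ} (h : SymUni f n₁) (hn : 2 ≤ n₁) :
    (∀ i, f i = (if i ≤ n₁ then f 0 else 0) + (if 1 ≤ i then (f (i - 1 + 1) - f 0) else 0))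
      ∧ SymUni (fun j => f (j + 1) - f 0) (n₁ - 2) := by
  have h0 : ∀ i, i ≤ n₁ → f 0 ≤ f i := fun i hi => h.le_of_between i 0 (by omega) (by omega)
  refine ⟨fun i => ?_, ⟨fun j hj => ?_, fun j hj => ?_, fun j hj => ?_⟩⟩
  · rcases Nat.eq_zero_or_pos i with rfl | hi
    · simp
    · rw [show i - 1 + 1 = i by omega]
      have hi1 : 1 ≤ i := hi
      by_cases hle : i ≤ n₁
      · have := h0 i hle
        simp only [hle, if_true, hi1]; omega
      · have := h.zero i (by omega)
        simp only [hle, if_false, hi1, if_true, this]; omega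
  · by_cases hj1 : n₁ < j + 1
    · have := h.zero (j + 1) hj1; omega
    · have e1 : j + 1 = n₁ := by omega
      have := h.symm (j + 1) (by omega)
      rw [e1, Nat.sub_self] at this
      rw [e1, this]; omega
  · have e : n₁ - 2 - j + 1 = n₁ - (j + 1) := by omega
    rw [e, ← h.symm (j + 1) (by omega)]
  · have h1 := h.mono (j + 1) (by omega)
    have h2 := h0 (j + 1) (by omega)
    rw [show j + 1 + 1 = j + 2 by omega] at h1
    rw [show j + 1 + 1 = j + 2 by omega]; omega

/-- **the convolution of two symmetric unimodal sequences is non-decreasing on the left half of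
`[0, n₁ + n₂]`** (induction on `n₁` by peeling the outermost level) -/
theorem conv_mono : ∀ (n₁ : ℕ) {f g : ℕ → ℕ} {n₂ : ℕ}, SymUni f n₁ → SymUni g n₂ →
    ∀ i, 2 * i + 2 ≤ n₁ + n₂ → conv f g i ≤ conv f g (i + 1)
  | 0, f, g, n₂, hf, hg, i, hi => by
    have e : ∀ m, conv f g m = f 0 * window 0 g m := by
      intro m; rw [← conv_level]
      unfold conv; refine Finset.sum_congr rfl (fun i₁ _ => ?_)
      rcases Nat.eq_zero_or_pos i₁ with rfl | hpos
      · simp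
      · rw [hf.zero i₁ hpos]; simp [Nat.not_le.2 hpos]
    rw [e, e]
    exact Nat.mul_le_mul_left _ (window_mono hg 0 i (by omega))
  | 1, f, g, n₂, hf, hg, i, hi => by
    have e : ∀ m, conv f g m = f 0 * window 1 g m := by
      intro m; rw [← conv_level]
      unfold conv; refine Finset.sum_congr rfl (fun i₁ _ => ?_)
      rcases (by omega : i₁ = 0 ∨ i₁ = 1 ∨ 2 ≤ i₁) with rfl | rfl | h2
      · simp
      · have := hf.symm 1 le_rfl; simp only [Nat.sub_self] at this; rw [this]; simp
      · rw [hf.zero i₁ (by omega)]; simp [show ¬ (i₁ ≤ 1) by omega]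
    rw [e, e]
    exact Nat.mul_le_mul_left _ (window_mono hg 1 i (by omega))
  | n₁ + 2, f, g, n₂, hf, hg, i, hi => by
    obtain ⟨hdec, hf''⟩ := hf.peel (by omega)
    have e : ∀ m, conv f g m
        = conv (fun i => if i ≤ n₁ + 2 then f 0 else 0) g m
          + conv (fun i => if 1 ≤ i then (fun j => f (j + 1) - f 0) (i - 1) else 0) g m := by
      intro m; rw [← conv_add]; unfold conv
      refine Finset.sum_congr rfl (fun i₁ _ => ?_)
      rw [hdec i₁]
    rw [e, e, conv_level, conv_level, conv_shift (fun j => f (j + 1) - f 0) g i]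
    have hW := window_mono hg (n₁ + 2) i hi
    have hC : conv (fun i => if 1 ≤ i then (fun j => f (j + 1) - f 0) (i - 1) else 0) g i
        ≤ conv (fun j => f (j + 1) - f 0) g i := by
      rcases Nat.eq_zero_or_pos i with rfl | hpos
      · rw [conv_shift_zero (fun j => f (j + 1) - f 0) g]; exact Nat.zero_le _
      · obtain ⟨k, rfl⟩ : ∃ k, i = k + 1 := ⟨i - 1, by omega⟩
        rw [conv_shift (fun j => f (j + 1) - f 0) g k]
        exact conv_mono n₁ hf'' hg k (by omega)
    exact Nat.add_le_add (Nat.mul_le_mul_left _ hW) hC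

end Summit.Ventures.PercRepro2.Unimodal
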